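/-
Origin: expansion seat `prover-pub-hodgecm-mc-binder-1-g15-0`, handover #R93 2026-08-20T18:37:14Z md5 2698cca011ec (219 l.; NEW additive universe-free leaf; imports Model/LevelCovering + Vendored UnitaryBallHolomorphicTranslate only; drops ⇒ {#R94, #R97}; NAME LIST: HodgeCM.Model.LevelCoveringTwist.twistMap_modelUnif · HodgeCM.Model.LevelCoveringTwist.mdifferentiable_twistMap · HodgeCM.Model.LevelCoveringTwist.exists_hom_map_unif_eq_mulVec) (`HOME/mc/pub-hodgecm-mc-binder-1-g15/stage59/HodgeCM/Model/LevelCoveringTwist.lean`, md5 2698cca011ec, 219 lines);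
landed by the gen-24 packager (p-g24) in gate run 59 as `HodgeCM/Model/LevelCoveringTwist.lean` (verbatim).
-/
/-
Copyright (c) 2026 the pub-hodgecm formalisation cell (harness21).  New file, not vendored.
Origin: session prover-pub-hodgecm-mc-binder-1-g15-0 (unit pub-hodgecm-mc-binder-1-g15, BINDER PROVER gen 15 of lineage mc-binder-1;
content lane (J-Liu-Θ), scope memo `HOME/mc/pub-hodgecm-mc-binder-1-g14/JLIU-THETA-SCOPE.md` §9 (J2), HECKE-TOWER sub-leaf (α1)-twist:
«the Hecke-translated projection `π_g : N\𝔹² → Γ\𝔹²`, `[v] ↦ [g v]`, is a morphism of the algebraic models»), 2026-08-20.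
Intended final place: `HodgeCM/Model/LevelCoveringTwist.lean` (NEW additive leaf, universe-free; imports ONLY the PKG module
`HodgeCM.Model.LevelCovering` (glue-1, RUN 33) and the vendored twin `…ShimuraVarieties.UnitaryBallHolomorphicTranslate`; nothing imports it;
drop alone on bounce).
-/
import Summits.HodgeConjecture.HodgeCM.Model.LevelCovering
import Literature.AlgebraicGeometry.ShimuraVarieties.UnitaryBallHolomorphicTranslate

set_option autoImplicit false

/-!
# Hecke-translated level coverings of compact ball quotients are holomorphic, hence morphisms of the models

The TWISTED companion of `HodgeCM.Model.LevelCovering` (glue-1): let `D₁ : UnitaryBallUniformisationDatum 2 X₁`,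
`D₂ : UnitaryBallUniformisationDatum 2 X₂` be ball uniformizations `Γ₁\𝔹² ≅ X₁(ℂ)`, `Γ₂\𝔹² ≅ X₂(ℂ)` with THE SAME complex
hermitian space (`D₁.Hℂ = D₂.Hℂ`), and let `g ∈ U(H^{τ₁}) = D₂.realPoints` (an isometry of `V_{τ₁}`, e.g. `g = γ^{τ₁}` for a
RATIONAL `γ ∈ U(V)(F)`) CONJUGATE `Γ₁` INTO `Γ₂`: `g Γ₁^{τ₁} g⁻¹ ≤ Γ₂^{τ₁}` (`ConjInto`).  This is the situation of the second
projection `π_g : N\𝔹² → Γ\𝔹²`, `N[v] ↦ Γ[g v]`, of the Hecke correspondence of `g` (`N = N_g ≤ Γ ∩ g⁻¹Γg`; vendored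
`HeckeCorrespondenceAction`: `coverMap`, `IsHeckeAdmissible.twist`) — there a map of TOPOLOGICAL orbit spaces; here, between the
ALGEBRAIC models of the two levels.  We prove, exactly parallel to `LevelCovering`:

* `unif_mulVec_eq_of_unif_eq` — `v ↦ unif₂ (g v)` is constant on the fibres of `unif₁`;
* `twistPts D₁ D₂ g : X₁(ℂ) → X₂(ℂ)`, `unif₁ v ↦ unif₂ (g v)` (`twistPts_unif`), read in Hodge models as
  `twistMap D₁ D₂ g A₁ A₂ : X₁^an → X₂^an` with `twistMap ∘ ψ₁ = ψ₂ ∘ (h •)` on the ball, `h = frameIso 𝔣 g ∈ U(2,1)`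
  (`twistMap_modelUnif`);
* `mdifferentiable_twistMap` — `twistMap` is HOLOMORPHIC (`= ψ₂ ∘ (h ·) ∘ g_c ∘ chart` near any point, `h ·` = the
  fractional-linear action, holomorphic on the ball by the vendored `BallForms.differentiableAt_actVec`);
* `exists_hom_map_unif_eq_mulVec` — under the record `Arapura2012_Cor_15_4_6` there is a morphism `f : X₁ ⟶ X₂` of
  `ℂ`-schemes with `f(ℂ) (unif₁ v) = unif₂ (g v)` on the cone: **the Hecke translate is a morphism of the algebraic models**.

With `g = 1` these are the statements of `LevelCovering`.  KIND: kernel constructions + theorems over the vendored tree modules;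
the Arapura record enters only as the hypothesis of the last theorem (as in `LevelCovering` / `Model.coverOf`).  Nothing cited anew,
nothing minted; 0 proof holes; expected `#print axioms` ⊆ {propext, Classical.choice, Quot.sound}.

References: G. Shimura, *Introduction to the arithmetic theory of automorphic functions* (1971), §7.2–7.3 (the two projections of a
modular correspondence); N. Bergeron, J. Millson, C. Moeglin, Acta Math. 216 (2016), Part 2 §1.8 (Hecke correspondences on ball
quotients are algebraic); D. Arapura, *Algebraic Geometry over the Complex Numbers* (2012), §15.4 Cor. 15.4.6.
-/

noncomputable section

open Matrix Function Set Filter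
open scoped Manifold Topology
open Literature.Geometry.ComplexHyperbolic
open Literature.Geometry.ComplexHyperbolic.BallModel (U21 Ball actVec)
open Literature.NumberTheory.Transcendental
open Literature.AlgebraicGeometry.HodgeTheory (HodgeModel)
open Literature.AlgebraicGeometry.Motives (SchemeOver ComplexPoints AlgPoints)
open CategoryTheory

namespace HodgeCM.Model.LevelCoveringTwist

open Literature.AlgebraicGeometry.ShimuraVarieties UnitaryBallUniformisationDatum
open HodgeCM.Model.LevelCovering (cone_eq_of_Hℂ_eq coneSec coneSec_mem unif_coneSec frameTransfer frameTransfer_T)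

variable {X₁ X₂ : SchemeOver ℂ} {D₁ : UnitaryBallUniformisationDatum 2 X₁} {D₂ : UnitaryBallUniformisationDatum 2 X₂}

/-- **`g` conjugates `Γ₁` into `Γ₂`** (read in `GL₃(ℂ)` through the distinguished embeddings): `g γ^{τ₁} g⁻¹ ∈ Γ₂^{τ₁}` for
every `γ ∈ Γ₁` — the hypothesis `g N g⁻¹ ⊆ Γ` of the translated projection `N[v] ↦ Γ[g v]` of a Hecke correspondence.
[cite: Shimura1973, §3.1] -/
def ConjInto (D₁ : UnitaryBallUniformisationDatum 2 X₁) (D₂ : UnitaryBallUniformisationDatum 2 X₂) (g : GL (Fin 3) ℂ) : Prop :=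
  ∀ γ ∈ D₁.Γ, g * Matrix.GeneralLinearGroup.map D₁.τ₁ γ * g⁻¹ ∈ D₂.Γ.map (Matrix.GeneralLinearGroup.map D₂.τ₁)

/-- A level pair `Γ₁^{τ₁} ≤ Γ₂^{τ₁}` is the case `g = 1`. [folklore] -/
theorem conjInto_one_of_le (hΓ : D₁.Γ.map (Matrix.GeneralLinearGroup.map D₁.τ₁) ≤ D₂.Γ.map (Matrix.GeneralLinearGroup.map D₂.τ₁)) :
    ConjInto D₁ D₂ 1 := fun γ hγ ↦ by
  simpa using hΓ (Subgroup.mem_map_of_mem _ hγ)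

/-! ### The point-level translate `unif₁ v ↦ unif₂ (g v)` -/

/-- An isometry of the common hermitian space preserves the cone of `D₁`. [folklore] -/
theorem mulVec_mem_cone (hH : D₁.Hℂ = D₂.Hℂ) {g : GL (Fin 3) ℂ} (hg : g ∈ D₂.realPoints) {v : Fin 3 → ℂ} (hv : v ∈ D₁.cone) :
    (g : Matrix (Fin 3) (Fin 3) ℂ) *ᵥ v ∈ D₂.cone :=
  ConeChart.mulVec_mem_negCone hg (by rw [← hH]; exact hv)

/-- **`v ↦ unif₂ (g v)` is constant on the fibres of `unif₁`** when `g` conjugates `Γ₁` into `Γ₂`: if `γ v = c w` with `γ ∈ Γ₁`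
then `(g γ g⁻¹)(g v) = c (g w)` with `g γ g⁻¹ ∈ Γ₂`. [cite: Shimura1973, §7.3] -/
theorem unif_mulVec_eq_of_unif_eq (hH : D₁.Hℂ = D₂.Hℂ) {g : GL (Fin 3) ℂ} (hg : g ∈ D₂.realPoints) (hΓ : ConjInto D₁ D₂ g)
    {v w : Fin 3 → ℂ} (hv : v ∈ D₁.cone) (hw : w ∈ D₁.cone) (h : D₁.unif v = D₁.unif w) :
    D₂.unif ((g : Matrix (Fin 3) (Fin 3) ℂ) *ᵥ v) = D₂.unif ((g : Matrix (Fin 3) (Fin 3) ℂ) *ᵥ w) := by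
  obtain ⟨γ, hγ, c, hc, hγv⟩ := (D₁.unif_eq_unif_iff v hv w hw).1 h
  obtain ⟨γ₂, hγ₂, hγeq⟩ := Subgroup.mem_map.1 (hΓ γ hγ)
  refine (D₂.unif_eq_unif_iff _ (mulVec_mem_cone hH hg hv) _ (mulVec_mem_cone hH hg hw)).2 ⟨γ₂, hγ₂, c, hc, ?_⟩
  have hmat := congrArg (fun u : GL (Fin 3) ℂ ↦ (u : Matrix (Fin 3) (Fin 3) ℂ)) hγeq
  simp only [coe_generalLinearGroup_map, Units.val_mul] at hmat
  rw [hmat, ← mulVec_mulVec, ← mulVec_mulVec]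
  -- `g⁻¹ (g v) = v`
  have hinv : ((g⁻¹ : GL (Fin 3) ℂ) : Matrix (Fin 3) (Fin 3) ℂ) *ᵥ ((g : Matrix (Fin 3) (Fin 3) ℂ) *ᵥ v) = v := by
    rw [mulVec_mulVec, ← Units.val_mul, inv_mul_cancel, Units.val_one, one_mulVec]
  rw [hinv]
  change (g : Matrix (Fin 3) (Fin 3) ℂ) *ᵥ (((γ : GL (Fin 3) D₁.E) : Matrix (Fin 3) (Fin 3) D₁.E).map D₁.τ₁ *ᵥ v) = _
  rw [hγv, mulVec_smul]

variable (D₁ D₂) in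
/-- **The Hecke-translated covering on complex points** `X₁(ℂ) → X₂(ℂ)`, `P ↦ unif₂ (g · any cone vector over P)`.
[cite: Shimura1973, §7.3] -/
def twistPts (g : GL (Fin 3) ℂ) (P : ComplexPoints X₁) : ComplexPoints X₂ :=
  D₂.unif ((g : Matrix (Fin 3) (Fin 3) ℂ) *ᵥ coneSec D₁ P)

/-- `twistPts (unif₁ v) = unif₂ (g v)` on the cone. [cite: Shimura1973, §7.3] -/
theorem twistPts_unif (hH : D₁.Hℂ = D₂.Hℂ) {g : GL (Fin 3) ℂ} (hg : g ∈ D₂.realPoints) (hΓ : ConjInto D₁ D₂ g)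
    {v : Fin 3 → ℂ} (hv : v ∈ D₁.cone) :
    twistPts D₁ D₂ g (D₁.unif v) = D₂.unif ((g : Matrix (Fin 3) (Fin 3) ℂ) *ᵥ v) :=
  unif_mulVec_eq_of_unif_eq hH hg hΓ (coneSec_mem _) hv (unif_coneSec _)

/-- With `g = 1` the translate is glue-1's `levelPts`. [folklore] -/
theorem twistPts_one : twistPts D₁ D₂ 1 = LevelCovering.levelPts D₁ D₂ := by
  funext P
  simp [twistPts, LevelCovering.levelPts]

/-! ### The translate read in Hodge models -/

variable (D₁ D₂) in
/-- **The Hecke-translated covering of the analytifications** `X₁^an → X₂^an` (Hodge models `A₁`, `A₂`): `twistPts`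
conjugated by the homeomorphisms `Xᵢ^an ≃ₜ Xᵢ(ℂ)`. [cite: Shimura1973, §7.3] [cite: SerreGAGA1956, §2] -/
def twistMap (g : GL (Fin 3) ℂ) (A₁ : HodgeModel 2 X₁) (A₂ : HodgeModel 2 X₂) (x : A₁.carrier) : A₂.carrier :=
  A₂.isAnalytification.homeomorph.symm (twistPts D₁ D₂ g (A₁.toComplexPoints x))

variable {A₁ : HodgeModel 2 X₁} {A₂ : HodgeModel 2 X₂}

/-- `twistMap` lies over `twistPts`. [folklore] -/
theorem toComplexPoints_twistMap (g : GL (Fin 3) ℂ) (x : A₁.carrier) :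
    A₂.toComplexPoints (twistMap D₁ D₂ g A₁ A₂ x) = twistPts D₁ D₂ g (A₁.toComplexPoints x) :=
  A₂.isAnalytification.homeomorph.apply_symm_apply _

/-- The frame section intertwines `g` on the cone with `h = frameIso 𝔣 g` on the ball up to the line: `unif₂ (g · T(z,1)) =
unif₂ (T(h z, 1))` (chart equivariance `coneChart_smul` + `unif` is constant on punctured lines). [cite: BergeronMillsonMoeglin2016Balls, Part 2 §1.3] -/
theorem unif_mulVec_coneLift (𝔣 : D₂.SylvesterFrame) (g : D₂.realPoints) (z : Ball) :
    D₂.unif (((g : GL (Fin 3) ℂ) : Matrix (Fin 3) (Fin 3) ℂ) *ᵥ (D₂.coneLift 𝔣 z : Fin 3 → ℂ)) =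
      D₂.unif (D₂.coneLift 𝔣 (D₂.frameIso 𝔣 g • z) : Fin 3 → ℂ) := by
  have h : D₂.coneChart 𝔣 (g • D₂.coneLift 𝔣 z) = D₂.coneChart 𝔣 (D₂.coneLift 𝔣 (D₂.frameIso 𝔣 g • z)) := by
    rw [D₂.coneChart_smul, D₂.coneChart_coneLift, D₂.coneChart_coneLift]
  have := D₂.unif_eq_of_coneChart_eq 𝔣 h
  rwa [ConeChart.coe_smul] at this

/-- **`twistMap ∘ ψ₁ = ψ₂ ∘ (h •)` on the ball**, `h = frameIso 𝔣 g ∈ U(2,1)`, for the uniformizations read in a common frame.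
[cite: Shimura1973, §7.3] [cite: BergeronMillsonMoeglin2016Balls, Introduction §1.1] -/
theorem twistMap_modelUnif (hH : D₁.Hℂ = D₂.Hℂ) (g : D₂.realPoints) (hΓ : ConjInto D₁ D₂ g)
    (𝔣 : D₂.SylvesterFrame) (z : Ball) :
    twistMap D₁ D₂ g A₁ A₂ (D₁.modelUnif A₁ (frameTransfer D₁ hH 𝔣) z.1) = D₂.modelUnif A₂ 𝔣 (D₂.frameIso 𝔣 g • z).1 := by
  unfold twistMap
  rw [toComplexPoints_modelUnif, ballUnifMap_apply, twistPts_unif hH g.2 hΓ (D₁.coneLift _ z).2]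
  have hlift : ((D₁.coneLift (frameTransfer D₁ hH 𝔣) z : D₁.cone) : Fin 3 → ℂ) = (D₂.coneLift 𝔣 z : Fin 3 → ℂ) := rfl
  rw [hlift, unif_mulVec_coneLift 𝔣 g z]
  rfl

/-- **The Hecke-translated covering is holomorphic.** Near `x = ψ₁ z`, with `g_c` a holomorphic local inverse of `ψ₁` in the
chart `c` at `x` (`ChartInverse`), `twistMap = ψ₂ ∘ (h ·) ∘ g_c ∘ c`, a composite of holomorphic maps (the fractional-linear
action `h ·` is holomorphic on the ball, `BallForms.differentiableAt_actVec`). [cite: FritzscheGrauert2002, Ch. I §8 Cor. 8.6]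
[cite: Shimura1973, §7.3] -/
theorem mdifferentiable_twistMap (hH : D₁.Hℂ = D₂.Hℂ) (g : D₂.realPoints) (hΓ : ConjInto D₁ D₂ g) (𝔣 : D₂.SylvesterFrame) :
    MDifferentiable 𝓘(ℂ, A₁.model) 𝓘(ℂ, A₂.model) (twistMap D₁ D₂ g A₁ A₂) := by
  intro x
  obtain ⟨z, hz⟩ := D₁.exists_modelUnif_eq A₁ (frameTransfer D₁ hH 𝔣) x
  obtain ⟨c⟩ := D₁.nonempty_chartInverse A₁ (frameTransfer D₁ hH 𝔣) z
  set φ := extChartAt 𝓘(ℂ, A₁.model) x with hφ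
  have hcenter : φ x ∈ c.W := by
    rw [hφ, ← hz]
    exact c.center_mem
  -- `twistMap = ψ₂ ∘ actVec h ∘ g_c ∘ φ` near `x`, `h = frameIso 𝔣 g`
  have key : twistMap D₁ D₂ g A₁ A₂ =ᶠ[𝓝 x] fun x' ↦ D₂.modelUnif A₂ 𝔣 (actVec (D₂.frameIso 𝔣 g) (c.g (φ x'))) := by
    have h1 : ∀ᶠ x' in 𝓝 x, x' ∈ (chartAt A₁.model x).source :=
      (chartAt A₁.model x).open_source.mem_nhds (mem_chart_source _ x)
    have h2 : ∀ᶠ x' in 𝓝 x, φ x' ∈ c.W :=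
      (continuousAt_extChartAt (I := 𝓘(ℂ, A₁.model)) x).eventually (c.isOpen.mem_nhds hcenter)
    filter_upwards [h1, h2] with x' hx₁ hx₂
    have hsrc : x' ∈ φ.source := by rwa [hφ, extChartAt_source]
    have hball : c.g (φ x') ∈ BallForms.ballSet := c.mapsTo hx₂
    obtain ⟨zb, hzb⟩ : ∃ zb : Ball, zb.1 = c.g (φ x') := ⟨⟨_, hball⟩, rfl⟩
    have hx' : x' = D₁.modelUnif A₁ (frameTransfer D₁ hH 𝔣) zb.1 := by
      rw [hzb, ← c.symm_eq (φ x') hx₂, hz]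
      exact (φ.left_inv hsrc).symm
    rw [← hzb, BallModel.actVec_eq, hx']
    exact twistMap_modelUnif hH g hΓ 𝔣 zb
  refine MDifferentiableAt.congr_of_eventuallyEq ?_ key
  have hφd : MDifferentiableAt 𝓘(ℂ, A₁.model) 𝓘(ℂ, A₁.model) φ x :=
    mdifferentiableAt_extChartAt (mem_chart_source _ x)
  have hg' : MDifferentiableAt 𝓘(ℂ, A₁.model) 𝓘(ℂ, Fin 2 → ℂ) c.g (φ x) :=
    mdifferentiableAt_iff_differentiableAt.2 (c.differentiableAt hcenter)
  have hact : MDifferentiableAt 𝓘(ℂ, Fin 2 → ℂ) 𝓘(ℂ, Fin 2 → ℂ) (actVec (D₂.frameIso 𝔣 g)) (c.g (φ x)) :=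
    mdifferentiableAt_iff_differentiableAt.2 (BallForms.differentiableAt_actVec _ (c.mapsTo hcenter))
  have hψ : MDifferentiableAt 𝓘(ℂ, Fin 2 → ℂ) 𝓘(ℂ, A₂.model) (D₂.modelUnif A₂ 𝔣) (actVec (D₂.frameIso 𝔣 g) (c.g (φ x))) :=
    (D₂.unifHolomorphic A₂ 𝔣).mdifferentiableAt
      (BallForms.isOpen_ballSet.mem_nhds (BallForms.actVec_mem_ballSet _ (c.mapsTo hcenter)))
  have hcomp : MDifferentiableAt 𝓘(ℂ, A₁.model) 𝓘(ℂ, A₂.model)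
      (D₂.modelUnif A₂ 𝔣 ∘ (actVec (D₂.frameIso 𝔣 g) ∘ (c.g ∘ φ))) x :=
    hψ.comp x (hact.comp x (hg'.comp x hφd))
  exact hcomp

/-! ### Algebraicity: the Hecke translate is a morphism of the models -/

/-- **The Hecke-translated level covering is a morphism of the algebraic models** (under the record `Arapura2012_Cor_15_4_6`:
a holomorphic map between nonsingular projective varieties is a morphism): for two ball uniformizations with the same hermitian
space and `g ∈ U(H^{τ₁})` with `g Γ₁^{τ₁} g⁻¹ ≤ Γ₂^{τ₁}` there is `f : X₁ ⟶ X₂` over `ℂ` with `f(ℂ) (unif₁ v) = unif₂ (g v)` on the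
cone.  The Hodge models `A₁`, `A₂` (analytifications) are inputs; the conclusion does not mention them.  For `g = γ^{τ₁}`,
`γ ∈ U(V)(F)`, `Γ₁ = N_γ`, `Γ₂ = Γ` this is the second projection `π_γ` of the Hecke correspondence `T_γ` as an algebraic map
`X_{N_γ} ⟶ X_Γ`. [cite: Arapura2012, §15.4 Cor. 15.4.6] [cite: BergeronMillsonMoeglin2016Balls, Part 2 §1.8] -/
theorem exists_hom_map_unif_eq_mulVec (hA : Arapura2012_Cor_15_4_6) (hH : D₁.Hℂ = D₂.Hℂ) {g : GL (Fin 3) ℂ}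
    (hg : g ∈ D₂.realPoints) (hΓ : ConjInto D₁ D₂ g) (A₁ : HodgeModel 2 X₁) (A₂ : HodgeModel 2 X₂) :
    ∃ f : X₁ ⟶ X₂, ∀ v ∈ D₁.cone, AlgPoints.map f (D₁.unif v) = D₂.unif ((g : Matrix (Fin 3) (Fin 3) ℂ) *ᵥ v) := by
  obtain ⟨𝔣⟩ := D₂.nonempty_sylvesterFrame
  obtain ⟨f, hf⟩ := hA X₁ X₂ D₁.isSmoothProjective D₂.isSmoothProjective A₁.model A₁.carrier
    A₁.toComplexPoints A₁.isAnalytification A₂.model A₂.carrier A₂.toComplexPoints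
    A₂.isAnalytification (twistMap D₁ D₂ g A₁ A₂) (mdifferentiable_twistMap hH ⟨g, hg⟩ hΓ 𝔣)
  refine ⟨f, fun v hv ↦ ?_⟩
  have h := hf (A₁.isAnalytification.homeomorph.symm (D₁.unif v))
  rw [toComplexPoints_twistMap] at h
  have h' : A₁.toComplexPoints (A₁.isAnalytification.homeomorph.symm (D₁.unif v)) = D₁.unif v :=
    A₁.isAnalytification.homeomorph.apply_symm_apply _
  rw [h', twistPts_unif hH hg hΓ hv] at h
  exact h.symm

end HodgeCM.Model.LevelCoveringTwist

end
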